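import Summits.ResolutionOfSingularities.ResolutionOfSingularities.Theorems.PurelyInseparableDim4AtlasMemberDefs
import HarnessLib

/-!
# Purely inseparable four-folds: OWNED SUBSPACES of atlas readings — set algebra (brick S3 (c) v4, tranche 1, brick A1c; cell `res-dim4-pi`)

[OURS · counted 0] (D-0157 DOOR 2; host item stmt-ResolutionOfSingularities-16155, helper). Nothing here proves resolution of
singularities in dimension ≥ 4 / characteristic `p`. Book-keeping for `ownedSetZ` (v4 defs p711312) used by A1 to match the abstract owned
pieces of `owned_pieces_cover/_disjoint` (A1a p711726) with the deferral sets of `mainReading` / `extraReading`: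

* `ownedSetZ_eq_zeroLocus`, `isClosed_ownedSetZ`, `ownedSetZ_mono`, `ownedSetZ_union`, `ownedSetZ_insert`,
  **`ownedSetZ_image_zero`** (deferring the pairs `(i, 0)`, `i ∈ Q`, cuts `V(z, x_T)` by `x_i = 0`, `i ∈ Q` — the owned piece of A1a),
  `ownedSetZ_subset_CΛ`.

AI-produced formalisation, weaker than expert review. bears_on: LADDER-RESOLUTION:D157-DOOR2 (res-dim4-pi · S3 (c) v4 A1c).
-/

set_option linter.dupNamespace false -- D-0017: single-problem summit path `Summit.<S>.<S>.…` by design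

noncomputable section

open MvPolynomial Finset CategoryTheory AlgebraicGeometry Opposite TopologicalSpace

namespace Summit.ResolutionOfSingularities.ResolutionOfSingularities.Theorems.PIDim4

open Literature.AlgebraicGeometry.Resolution
open Literature.AlgebraicGeometry.Resolution.AffinePointBlowup (P A γ coord Wtop ξ)

namespace Equimultiple

section OwnedSets

variable {K : Type} [Field K]

/-- The owned subspace is a zero locus. [folklore] -/
theorem ownedSetZ_eq_zeroLocus (T : Finset (Fin 4)) (Xd : Finset (Fin 4 × K)) :
    ownedSetZ T Xd = PrimeSpectrum.zeroLocus
      (((fun k : Fin (4 + 1) => (X k : A 4 K)) '' (insert 0 (Fin.succ '' (T : Set (Fin 4))))) ∪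
        ((fun iv : Fin 4 × K => (X iv.1.succ - C iv.2 : A 4 K)) '' (Xd : Set (Fin 4 × K)))) := by
  ext x
  rw [ownedSetZ, Set.mem_setOf_eq, SetLike.mem_coe, AffineCoordBlowup.mem_CΛ_iff']
  show _ ↔ (((fun k : Fin (4 + 1) => (X k : A 4 K)) '' (insert 0 (Fin.succ '' (T : Set (Fin 4))))) ∪
      ((fun iv : Fin 4 × K => (X iv.1.succ - C iv.2 : A 4 K)) '' (Xd : Set (Fin 4 × K)))) ⊆ (x.asIdeal : Set (A 4 K))
  rw [Set.union_subset_iff, Set.image_subset_iff, Set.image_subset_iff]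
  exact ⟨fun h => ⟨fun k hk => h.1 k hk, fun iv hiv => h.2 iv hiv⟩, fun h => ⟨fun k hk => h.1 hk, fun iv hiv => h.2 hiv⟩⟩

/-- **The owned subspace is closed.** [folklore] -/
theorem isClosed_ownedSetZ (T : Finset (Fin 4)) (Xd : Finset (Fin 4 × K)) : IsClosed (ownedSetZ T Xd) := by
  rw [ownedSetZ_eq_zeroLocus]
  exact PrimeSpectrum.isClosed_zeroLocus _

/-- The owned subspace lies in `V(z, x_T)`. [folklore] -/
theorem ownedSetZ_subset_CΛ (T : Finset (Fin 4)) (Xd : Finset (Fin 4 × K)) :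
    ownedSetZ T Xd ⊆ (AffineCoordBlowup.CΛ 4 K (insert 0 (Fin.succ '' (T : Set (Fin 4)))) : Set (P 4 K)) := fun _ h => h.1

/-- More deferrals, smaller owned subspace. [folklore] -/
theorem ownedSetZ_mono (T : Finset (Fin 4)) {Xd Xd' : Finset (Fin 4 × K)} (h : Xd ⊆ Xd') : ownedSetZ T Xd' ⊆ ownedSetZ T Xd :=
  fun _ hx => ⟨hx.1, fun iv hiv => hx.2 iv (h hiv)⟩

/-- Deferral sets add, owned subspaces intersect. [folklore] -/
theorem ownedSetZ_union [DecidableEq K] (T : Finset (Fin 4)) (Xd Xd' : Finset (Fin 4 × K)) :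
    ownedSetZ T (Xd ∪ Xd') = ownedSetZ T Xd ∩ ownedSetZ T Xd' := by
  ext x
  simp only [ownedSetZ, Set.mem_setOf_eq, Set.mem_inter_iff, Finset.mem_union]
  exact ⟨fun h => ⟨⟨h.1, fun iv hiv => h.2 iv (Or.inl hiv)⟩, ⟨h.1, fun iv hiv => h.2 iv (Or.inr hiv)⟩⟩,
    fun h => ⟨h.1.1, fun iv hiv => hiv.elim (h.1.2 iv) (h.2.2 iv)⟩⟩

/-- One more deferred pair cuts by one more hyperplane. [folklore] -/
theorem ownedSetZ_insert [DecidableEq K] (T : Finset (Fin 4)) (iv : Fin 4 × K) (Xd : Finset (Fin 4 × K)) :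
    ownedSetZ T (insert iv Xd) = ownedSetZ T Xd ∩ {x : P 4 K | (X iv.1.succ - C iv.2 : A 4 K) ∈ x.asIdeal} := by
  ext x
  simp only [ownedSetZ, Set.mem_setOf_eq, Set.mem_inter_iff, Finset.mem_insert, forall_eq_or_imp]
  exact ⟨fun h => ⟨⟨h.1, h.2.2⟩, h.2.1⟩, fun h => ⟨h.1.1, h.2, h.1.2⟩⟩

/-- **Deferring `(i, 0)` for `i ∈ Q` cuts `V(z, x_T)` by the coordinate hyperplanes `x_i = 0`, `i ∈ Q`** — the owned piece
`C ∩ V(x_{m′} : m′ earlier)` of `owned_pieces_cover` (A1a) in the format of the v4 definitions. [folklore] -/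
theorem ownedSetZ_image_zero [DecidableEq K] (T Q : Finset (Fin 4)) :
    ownedSetZ T (Q.image fun i => (i, (0 : K))) =
      (AffineCoordBlowup.CΛ 4 K (insert 0 (Fin.succ '' (T : Set (Fin 4)))) : Set (P 4 K)) ∩
        {x : P 4 K | ∀ i ∈ Q, (X i.succ : A 4 K) ∈ x.asIdeal} := by
  ext x
  simp only [ownedSetZ, Set.mem_setOf_eq, Set.mem_inter_iff, Finset.mem_image, forall_exists_index, and_imp]
  refine ⟨fun h => ⟨h.1, fun i hi => ?_⟩, fun h => ⟨h.1, ?_⟩⟩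
  · have := h.2 (i, (0 : K)) i hi rfl
    rwa [C_0, sub_zero] at this
  · rintro iv i hi rfl
    rw [C_0, sub_zero]
    exact h.2 i hi

end OwnedSets

end Equimultiple

end Summit.ResolutionOfSingularities.ResolutionOfSingularities.Theorems.PIDim4

end
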